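import Summits.ResolutionOfSingularities.ResolutionOfSingularities.Theorems.RisoStrataRtdLocalInvariance
import Summits.ResolutionOfSingularities.ResolutionOfSingularities.Theses.RisoStrata

/-!
# Crux `RtdLocal` of route RisoStrata (stmt-ResolutionOfSingularities-18840) — assembly

Zariski-locality of the typed riso-triviality dimension under `B ↦ B' := B[s⁻¹]`
(Monreal, arXiv:2606.12554, Prop 4.2 / Lemma 3.21 / Prop 4.4 / Cor 4.6, in the route's
Hahn-series encoding; characteristic-free): for a finitely generated `k`-subalgebra `B` of a
field `K`, `0 ≠ s ∈ B`, and a maximal ideal `m'` of `B'` contracting to `m`,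
`Rtd B' m' r ↔ Rtd B m r`.

Line `Sketch` (lead file). Ingredients, all landed under `Theorems/RisoStrataRtdLocal*.lean`:
cotangent invariance inside one algebra (`stub_invariance`), the arc bijection
`Arc B m ≃ Arc B' m'` (`stub_arcEquiv`), and "a presentation `g₀ ⊆ m` of `B` spans `m'/m'²`"
(`stub_cotangent_span`). Assembly:
* (→) `Rtd B' m' r` via `g'` ⟹ invariance in `B'` from `g'` to `incl ∘ g₀` (`g₀ ⊆ m` a
  presentation of `B`, from `B.FG` and `B/m = k`) ⟹ reindex the arcs ⟹ `Rtd B m r` via `g₀`;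
* (←) `Rtd B m r` via `g` ⟹ reindex the arcs ⟹ invariance in `B'` from the presentation
  `(u, incl ∘ g)` of `B'` inside `m'` (`u := s⁻¹ - c⁻¹`, `s ≡ c mod m`) to `incl ∘ g`, read
  backwards ⟹ `Rtd B' m' r`.
`IsAlgClosed`, `CharP` and maximality of `m'` beyond `m' ≠ ⊤` are not used; `B.FG` and `s ∈ B`
are (they are load-bearing: `Theorems/RtdLocal/Negative/*`).
-/

set_option linter.dupNamespace false

namespace Summit.ResolutionOfSingularities.ResolutionOfSingularities.Theorems

section General

variable {k : Type} [Field k]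

/-- Reindexing the ARCS along a bijection `e : ι ≃ ι'` compatible with the coordinates
transports the typed predicate. -/
theorem fin_reindexArcs {ι ι' J : Type} [Fintype J] (e : ι ≃ ι')
    (c : ι → J → HahnSeries ℚ k) (c' : ι' → J → HahnSeries ℚ k)
    (hc : ∀ a j, c' (e a) j = c a j) (r : ℕ)
    (h : ∃ W : Submodule k (J → k), r ≤ Module.finrank k W ∧
      ∃ φ : ι → J → HahnSeries ℚ k,
        (∀ a b, a ≠ b → ∃ j, ∀ i,
          (c a j - c b j).orderTop < ((φ a i - φ b i) - (c a i - c b i)).orderTop) ∧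
        (∀ a i, 0 < (φ a i).orderTop) ∧
        (∀ a (w : J → HahnSeries ℚ k), (∀ i, 0 < (w i).orderTop) →
          w ∈ Submodule.span (HahnSeries ℚ k)
            ((fun u : J → k => fun i => HahnSeries.C (u i)) '' (W : Set (J → k))) →
          ∃ b, φ b = φ a + w)) :
    ∃ W : Submodule k (J → k), r ≤ Module.finrank k W ∧
      ∃ φ : ι' → J → HahnSeries ℚ k,
        (∀ a b, a ≠ b → ∃ j, ∀ i,
          (c' a j - c' b j).orderTop < ((φ a i - φ b i) - (c' a i - c' b i)).orderTop) ∧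
        (∀ a i, 0 < (φ a i).orderTop) ∧
        (∀ a (w : J → HahnSeries ℚ k), (∀ i, 0 < (w i).orderTop) →
          w ∈ Submodule.span (HahnSeries ℚ k)
            ((fun u : J → k => fun i => HahnSeries.C (u i)) '' (W : Set (J → k))) →
          ∃ b, φ b = φ a + w) := by
  obtain ⟨W, hW, φ, h1, h2, h3⟩ := h
  have hc' : ∀ a' j, c' a' j = c (e.symm a') j := fun a' j => by
    rw [← hc, Equiv.apply_symm_apply]
  refine ⟨W, hW, fun a' => φ (e.symm a'), ?_, fun a' i => h2 _ i, ?_⟩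
  · intro a' b' hab
    obtain ⟨j, hj⟩ := h1 (e.symm a') (e.symm b') (fun h => hab (e.symm.injective h))
    refine ⟨j, fun i => ?_⟩
    simpa only [hc'] using hj i
  · intro a' w hw hwspan
    obtain ⟨b, hb⟩ := h3 (e.symm a') w hw hwspan
    refine ⟨e b, ?_⟩
    change φ (e.symm (e b)) = φ (e.symm a') + w
    rw [Equiv.symm_apply_apply, hb]

variable {A : Type} [CommRing A] [Algebra k A]

/-- A presentation inside the ideal `n` forces residue ring `k`: every element is congruent to a
constant modulo `n`. -/
theorem fin_residue (n : Ideal A) {J : Type} [Fintype J] (g : J → A) (hg : ∀ j, g j ∈ n)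
    (hgen : Algebra.adjoin k (Set.range g) = ⊤) (x : A) : ∃ c : k, x - algebraMap k A c ∈ n := by
  obtain ⟨c, u, h⟩ := cotspan_firstOrder n g hg hgen x
  refine ⟨c, ?_⟩
  have h1 : x - algebraMap k A c - ∑ j, algebraMap k A (u j) * g j ∈ n :=
    Ideal.pow_le_self two_ne_zero h
  have h2 : ∑ j, algebraMap k A (u j) * g j ∈ n :=
    Ideal.sum_mem _ fun j _ => n.mul_mem_left _ (hg j)
  simpa using add_mem h1 h2

/-- The CONSTANT ARC: if `n` is proper with residue ring `k`, the composite
`A → A/n ≅ k → k⟦t^ℚ⟧` is an arc centred at `n`; so the arc space is inhabited. -/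
theorem fin_nonempty_arc (n : Ideal A) (hn : n ≠ ⊤)
    (hres : ∀ x : A, ∃ c : k, x - algebraMap k A c ∈ n) :
    Nonempty {α : A →ₐ[k] HahnSeries ℚ k // ∀ x ∈ n, 0 < (α x).orderTop} := by
  haveI : Nontrivial (A ⧸ n) := Ideal.Quotient.nontrivial_iff.mpr hn
  have hinj : Function.Injective (algebraMap k (A ⧸ n)) := (algebraMap k (A ⧸ n)).injective
  have hsurj : Function.Surjective (algebraMap k (A ⧸ n)) := by
    intro y
    obtain ⟨x, rfl⟩ := Ideal.Quotient.mk_surjective y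
    obtain ⟨c, hc⟩ := hres x
    refine ⟨c, ?_⟩
    rw [IsScalarTower.algebraMap_apply k A (A ⧸ n), Ideal.Quotient.algebraMap_eq, eq_comm,
      Ideal.Quotient.mk_eq_mk_iff_sub_mem]
    exact hc
  let e : k ≃ₐ[k] (A ⧸ n) := AlgEquiv.ofBijective (Algebra.ofId k (A ⧸ n)) ⟨hinj, hsurj⟩
  let α : A →ₐ[k] HahnSeries ℚ k :=
    (Algebra.ofId k (HahnSeries ℚ k)).comp (e.symm.toAlgHom.comp (Ideal.Quotient.mkₐ k n))
  refine ⟨⟨α, fun b hb => ?_⟩⟩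
  have h0 : Ideal.Quotient.mk n b = 0 := Ideal.Quotient.eq_zero_iff_mem.2 hb
  simp [α, Ideal.Quotient.mkₐ_eq_mk, h0]

variable {K : Type} [Field K] [Algebra k K]

/-- A family of elements of a subalgebra `S ⊆ K` that generates `S` inside `K` generates `⊤`
inside `↥S`. -/
theorem fin_adjoin_top (S : Subalgebra k K) {J : Type} (g : J → ↥S)
    (hgen : Algebra.adjoin k (Set.range fun j => (g j : K)) = S) :
    Algebra.adjoin k (Set.range g) = ⊤ := by
  apply Subalgebra.map_injective (f := S.val) Subtype.val_injective
  rw [Algebra.map_top, Subalgebra.range_val, AlgHom.map_adjoin, ← Set.range_comp]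
  exact hgen

/-- A finitely generated `B ⊆ K` with residue ring `k` at `m` has a presentation INSIDE `m`
(shift the generators by their residues). This is where `B.FG` is consumed. -/
theorem fin_exists_presentation (B : Subalgebra k K) (hFG : B.FG) (m : Ideal B)
    (hres : ∀ x : B, ∃ c : k, x - algebraMap k B c ∈ m) :
    ∃ (N : ℕ) (g : Fin N → B), (∀ i, g i ∈ m) ∧
      Algebra.adjoin k (Set.range fun i => (g i : K)) = B := by
  classical
  obtain ⟨t, ht⟩ := hFG
  have htB : ∀ x ∈ t, x ∈ B := fun x hx => ht ▸ Algebra.subset_adjoin hx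
  let f : Fin t.card → K := fun i => (t.equivFin.symm i : K)
  have hf : ∀ i, f i ∈ t := fun i => (t.equivFin.symm i).2
  have hfsurj : ∀ x ∈ t, ∃ i, f i = x := fun x hx =>
    ⟨t.equivFin ⟨x, hx⟩, by simp [f]⟩
  choose c hc using fun i => hres ⟨f i, htB _ (hf i)⟩
  refine ⟨t.card, fun i => ⟨f i, htB _ (hf i)⟩ - algebraMap k B (c i), fun i => hc i, ?_⟩
  apply le_antisymm
  · rw [Algebra.adjoin_le_iff]
    rintro _ ⟨i, rfl⟩
    exact SetLike.coe_mem _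
  · refine ht.symm.trans_le ?_
    rw [Algebra.adjoin_le_iff]
    intro x hx
    obtain ⟨i, rfl⟩ := hfsurj x hx
    have : f i = ((⟨f i, htB _ (hf i)⟩ - algebraMap k B (c i) : B) : K) +
        algebraMap k K (c i) := by
      simp
    rw [this]
    exact Subalgebra.add_mem _ (Algebra.subset_adjoin ⟨i, rfl⟩) (Subalgebra.algebraMap_mem _ _)

end General

section Main

variable {k K : Type} [Field k] [Field K] [Algebra k K]

/-- **`RtdLocal`, unfolded**: for `B ⊆ K` finitely generated, `0 ≠ s ∈ B`, `B' = B[s⁻¹]` and a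
proper ideal `m'` of `B'`, the route's `Rtd B' m' r` holds iff `Rtd B (m' ∩ B) r` does. -/
theorem rtdLocal_iff (B : Subalgebra k K) (s : K) (hs : s ∈ B) (hs0 : s ≠ 0) (hB : B.FG)
    (hle : B ≤ Algebra.adjoin k ((B : Set K) ∪ {s⁻¹}))
    (m' : Ideal ↥(Algebra.adjoin k ((B : Set K) ∪ {s⁻¹}))) (hm' : m' ≠ ⊤) (r : ℕ) :
    (∃ (n : ℕ) (g : Fin n → ↥(Algebra.adjoin k ((B : Set K) ∪ {s⁻¹}))), (∀ i, g i ∈ m') ∧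
      Algebra.adjoin k (Set.range fun i => (g i : K)) = Algebra.adjoin k ((B : Set K) ∪ {s⁻¹}) ∧
      ∃ W : Submodule k (Fin n → k), r ≤ Module.finrank k W ∧
        ∃ φ : {α : ↥(Algebra.adjoin k ((B : Set K) ∪ {s⁻¹})) →ₐ[k] HahnSeries ℚ k //
              ∀ b ∈ m', 0 < (α b).orderTop} → Fin n → HahnSeries ℚ k,
          (∀ a b : {α : ↥(Algebra.adjoin k ((B : Set K) ∪ {s⁻¹})) →ₐ[k] HahnSeries ℚ k //
              ∀ b ∈ m', 0 < (α b).orderTop}, a ≠ b → ∃ j, ∀ i,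
            (a.1 (g j) - b.1 (g j)).orderTop <
              ((φ a i - φ b i) - (a.1 (g i) - b.1 (g i))).orderTop) ∧
          (∀ a i, 0 < (φ a i).orderTop) ∧
          (∀ a (w : Fin n → HahnSeries ℚ k), (∀ i, 0 < (w i).orderTop) →
            w ∈ Submodule.span (HahnSeries ℚ k)
              ((fun u : Fin n → k => fun i => HahnSeries.C (u i)) '' (W : Set (Fin n → k))) →
            ∃ b, φ b = φ a + w)) ↔
    (∃ (n : ℕ) (g : Fin n → ↥B), (∀ i, g i ∈ m'.comap (Subalgebra.inclusion hle)) ∧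
      Algebra.adjoin k (Set.range fun i => (g i : K)) = B ∧
      ∃ W : Submodule k (Fin n → k), r ≤ Module.finrank k W ∧
        ∃ φ : {α : ↥B →ₐ[k] HahnSeries ℚ k //
              ∀ b ∈ m'.comap (Subalgebra.inclusion hle), 0 < (α b).orderTop} →
            Fin n → HahnSeries ℚ k,
          (∀ a b : {α : ↥B →ₐ[k] HahnSeries ℚ k //
              ∀ b ∈ m'.comap (Subalgebra.inclusion hle), 0 < (α b).orderTop}, a ≠ b → ∃ j, ∀ i,
            (a.1 (g j) - b.1 (g j)).orderTop <
              ((φ a i - φ b i) - (a.1 (g i) - b.1 (g i))).orderTop) ∧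
          (∀ a i, 0 < (φ a i).orderTop) ∧
          (∀ a (w : Fin n → HahnSeries ℚ k), (∀ i, 0 < (w i).orderTop) →
            w ∈ Submodule.span (HahnSeries ℚ k)
              ((fun u : Fin n → k => fun i => HahnSeries.C (u i)) '' (W : Set (Fin n → k))) →
            ∃ b, φ b = φ a + w)) := by
  classical
  -- `s`, `s⁻¹` in `B'` and the contraction `m := m' ∩ B`
  have hinv : (s⁻¹ : K) ∈ Algebra.adjoin k ((B : Set K) ∪ {s⁻¹}) :=
    Algebra.subset_adjoin (Set.mem_union_right _ rfl)
  have hunit : IsUnit (Subalgebra.inclusion hle ⟨s, hs⟩) := by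
    refine isUnit_iff_exists_inv.2 ⟨⟨s⁻¹, hinv⟩, Subtype.ext ?_⟩
    simp [mul_inv_cancel₀ hs0]
  have hsm : (⟨s, hs⟩ : ↥B) ∉ m'.comap (Subalgebra.inclusion hle) := fun h =>
    hm' (Ideal.eq_top_of_isUnit_mem m' h hunit)
  have key : (∀ x : ↥B, ∃ c : k, x - algebraMap k ↥B c ∈ m'.comap (Subalgebra.inclusion hle)) →
      ∃ c : k, c ≠ 0 ∧ (⟨s, hs⟩ : ↥B) - algebraMap k ↥B c ∈ m'.comap (Subalgebra.inclusion hle) := by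
    intro hres
    obtain ⟨c, hc⟩ := hres ⟨s, hs⟩
    refine ⟨c, ?_, hc⟩
    rintro rfl
    apply hsm
    simpa using hc
  constructor
  · -- (→) from `B' = B[s⁻¹]` down to `B`
    rintro ⟨n', g', hg'm, hg'gen, hR'⟩
    have hg'top := fin_adjoin_top _ g' hg'gen
    have hres' := fin_residue m' g' hg'm hg'top
    have hres : ∀ x : ↥B, ∃ c : k,
        x - algebraMap k ↥B c ∈ m'.comap (Subalgebra.inclusion hle) := fun x => by
      obtain ⟨c, hc⟩ := hres' (Subalgebra.inclusion hle x)
      refine ⟨c, ?_⟩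
      rw [Ideal.mem_comap, map_sub, AlgHom.commutes]
      exact hc
    obtain ⟨c, hc0, hc⟩ := key hres
    have hne := fin_nonempty_arc m' hm' hres'
    obtain ⟨n₀, g₀, hg₀m, hg₀gen⟩ := fin_exists_presentation B hB _ hres
    -- `g' ≡ N (incl ∘ g₀) (mod m'²)`
    have hN : ∀ j, ∃ u : Fin n₀ → k, g' j - ∑ j', algebraMap k _ (u j') *
        Subalgebra.inclusion hle (g₀ j') ∈ m' ^ 2 := fun j =>
      stub_cotangent_span B s hs hs0 hle m' hm' hres' g₀ hg₀m hg₀gen (g' j) (hg'm j)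
    choose N hN using hN
    have hinv := (stub_invariance m' hm' g' hg'm hg'top
      (fun j' => Subalgebra.inclusion hle (g₀ j')) (fun j' => hg₀m j') N hN hne r).mp hR'
    obtain ⟨e, he⟩ := stub_arcEquiv B s hs hs0 hle m' c hc0 hc
    refine ⟨n₀, g₀, hg₀m, hg₀gen, ?_⟩
    exact fin_reindexArcs e.symm
      (fun (a' : {α : ↥(Algebra.adjoin k ((B : Set K) ∪ {s⁻¹})) →ₐ[k] HahnSeries ℚ k //
          ∀ b ∈ m', 0 < (α b).orderTop}) j' => a'.1 (Subalgebra.inclusion hle (g₀ j')))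
      (fun (a : {α : ↥B →ₐ[k] HahnSeries ℚ k //
          ∀ b ∈ m'.comap (Subalgebra.inclusion hle), 0 < (α b).orderTop}) j' => a.1 (g₀ j'))
      (fun a' j' => by rw [← he (e.symm a') (g₀ j'), Equiv.apply_symm_apply]) r hinv
  · -- (←) from `B` up to `B' = B[s⁻¹]`
    rintro ⟨n₁, g, hgm, hggen, hR⟩
    have hgtop := fin_adjoin_top _ g hggen
    have hres := fin_residue (m'.comap (Subalgebra.inclusion hle)) g hgm hgtop
    obtain ⟨c, hc0, hc⟩ := key hres
    -- the extra generator `u := s⁻¹ - c⁻¹ ∈ m'`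
    obtain ⟨u, hu⟩ : ∃ u : ↥(Algebra.adjoin k ((B : Set K) ∪ {s⁻¹})),
        u = ⟨s⁻¹, hinv⟩ - algebraMap k _ c⁻¹ := ⟨_, rfl⟩
    have huK : (u : K) = s⁻¹ - algebraMap k K c⁻¹ := by
      rw [hu]
      simp
    have hum : u ∈ m' := by
      have hd : Subalgebra.inclusion hle ((⟨s, hs⟩ : ↥B) - algebraMap k ↥B c) ∈ m' := hc
      have hueq : u = -(algebraMap k _ c⁻¹ * ⟨s⁻¹, hinv⟩) *
          Subalgebra.inclusion hle ((⟨s, hs⟩ : ↥B) - algebraMap k ↥B c) := by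
        apply Subtype.ext
        have hc0' : (algebraMap k K c) ≠ 0 := (map_ne_zero _).2 hc0
        rw [huK]
        simp only [map_sub, AlgHom.commutes, Subalgebra.coe_mul, Subalgebra.coe_neg,
          Subalgebra.coe_sub, Subalgebra.coe_algebraMap, Subalgebra.coe_inclusion, map_inv₀]
        field_simp
        ring
      rw [hueq]
      exact m'.mul_mem_left _ hd
    -- the presentation `G := (u, incl ∘ g)` of `B'` inside `m'`
    obtain ⟨G, hG⟩ : ∃ G : Fin (n₁ + 1) → ↥(Algebra.adjoin k ((B : Set K) ∪ {s⁻¹})),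
        G = Fin.cons u (fun i => Subalgebra.inclusion hle (g i)) := ⟨_, rfl⟩
    have hG0 : G 0 = u := by rw [hG, Fin.cons_zero]
    have hGs : ∀ i : Fin n₁, G i.succ = Subalgebra.inclusion hle (g i) := fun i => by
      rw [hG, Fin.cons_succ]
    have hGm : ∀ i, G i ∈ m' := by
      refine Fin.cases ?_ (fun i => ?_)
      · rw [hG0]; exact hum
      · rw [hGs]; exact hgm i
    have hGgen : Algebra.adjoin k (Set.range fun i => (G i : K)) =
        Algebra.adjoin k ((B : Set K) ∪ {s⁻¹}) := by
      apply le_antisymm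
      · rw [Algebra.adjoin_le_iff]
        rintro _ ⟨i, rfl⟩
        exact SetLike.coe_mem _
      · rw [Algebra.adjoin_le_iff]
        rintro y (hy | hy)
        · have hy' : y ∈ Algebra.adjoin k (Set.range fun i => (g i : K)) := by rwa [hggen]
          refine Algebra.adjoin_mono ?_ hy'
          rintro _ ⟨i, rfl⟩
          exact ⟨i.succ, by simp [hGs]⟩
        · rw [Set.mem_singleton_iff] at hy
          subst hy
          have : (s⁻¹ : K) = (G 0 : K) + algebraMap k K c⁻¹ := by
            rw [hG0, huK]
            ring
          have hmem : (G 0 : K) + algebraMap k K c⁻¹ ∈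
              Algebra.adjoin k (Set.range fun i => (G i : K)) :=
            add_mem (Algebra.subset_adjoin ⟨0, rfl⟩) (Subalgebra.algebraMap_mem _ _)
          rwa [← this] at hmem
    have hGtop := fin_adjoin_top _ G hGgen
    have hres' := fin_residue m' G hGm hGtop
    have hne := fin_nonempty_arc m' hm' hres'
    -- `G ≡ N (incl ∘ g) (mod m'²)`: the congruence for `u`, identity rows for the rest
    obtain ⟨μ, hμ⟩ := stub_cotangent_span B s hs hs0 hle m' hm' hres' g hgm hggen u hum
    obtain ⟨N, hN⟩ : ∃ N : Fin (n₁ + 1) → Fin n₁ → k,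
        N = Fin.cons μ (fun i => Pi.single i 1) := ⟨_, rfl⟩
    have hNG : ∀ i, G i - ∑ j', algebraMap k _ (N i j') *
        Subalgebra.inclusion hle (g j') ∈ m' ^ 2 := by
      refine Fin.cases ?_ (fun i => ?_)
      · rw [hG0, hN, Fin.cons_zero]
        exact hμ
      · rw [hGs, hN, Fin.cons_succ]
        have hsum : ∑ j', algebraMap k (↥(Algebra.adjoin k ((B : Set K) ∪ {s⁻¹})))
            (Pi.single (M := fun _ => k) i 1 j') * Subalgebra.inclusion hle (g j') =
            Subalgebra.inclusion hle (g i) := by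
          rw [Fintype.sum_eq_single i fun j hj => by
            rw [Pi.single_eq_of_ne hj, map_zero, zero_mul]]
          rw [Pi.single_eq_same, map_one, one_mul]
        rw [hsum, sub_self]
        exact zero_mem _
    obtain ⟨e, he⟩ := stub_arcEquiv B s hs hs0 hle m' c hc0 hc
    have hR₁ := fin_reindexArcs e
      (fun (a : {α : ↥B →ₐ[k] HahnSeries ℚ k //
          ∀ b ∈ m'.comap (Subalgebra.inclusion hle), 0 < (α b).orderTop}) j' => a.1 (g j'))
      (fun (a' : {α : ↥(Algebra.adjoin k ((B : Set K) ∪ {s⁻¹})) →ₐ[k] HahnSeries ℚ k //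
          ∀ b ∈ m', 0 < (α b).orderTop}) j' => a'.1 (Subalgebra.inclusion hle (g j')))
      (fun a j' => he a (g j')) r hR
    have hinv := (stub_invariance m' hm' G hGm hGtop
      (fun j' => Subalgebra.inclusion hle (g j')) (fun j' => hgm j') N hNG hne r).mpr hR₁
    exact ⟨n₁ + 1, G, hGm, hGgen, hinv⟩

end Main

open Summit.ResolutionOfSingularities.ResolutionOfSingularities.Theses.RisoStrata in
/-- **The crux `RtdLocal` of route RisoStrata** (stmt-ResolutionOfSingularities-18840; Monreal,
arXiv:2606.12554, Prop 4.2 / 4.4 + Cor 4.6 in the route's typed encoding): the typed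
riso-triviality dimension of `B[s⁻¹]` at a maximal ideal `m'` equals that of `B` at
`m' ∩ B`. Line `Sketch`, cotangent-invariance proof. -/
theorem RtdLocal_of : RtdLocal := by
  intro p _ k _ _ _ K _ _ B s hs hs0 hB
  dsimp only
  intro m' hm' r
  exact rtdLocal_iff B s hs hs0 hB _ m' hm'.ne_top r

end Summit.ResolutionOfSingularities.ResolutionOfSingularities.Theorems
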